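import Literature.Analysis.FluidPDE.MildL3SmoothOfKNSS
import Literature.Analysis.FluidPDE.NSBoundedMildOseenAssembly
import Literature.Analysis.FluidPDE.KNSSLocalSmoothingHolds
import HarnessLib

/-!
# Bounded mild `L³` solutions are classical (Lemarié-Rieusset 2016, Thm. 9.12; Giga 1986, Thm. 4) — discharged

Analysis/FluidPDE glue file **discharging the named fact
`Literature.Analysis.FluidPDE.classical_of_bounded_mild_L3`** (`MildL3Smooth.lean`; P. G.
Lemarié-Rieusset, *The Navier–Stokes Problem in the 21st Century* (2016), doi:10.1201/b19556,
Thm. 9.12, PDF pp. 260–263: a bounded mild solution is smooth (even analytic) in space and time;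
Y. Giga, J. Differential Equations 62 (1986), Thm. 4 and Remark p. 202; Koch–Nadirashvili–
Seregin–Šverák 2009, Prop. 4.1). The accepted tree reduction is
`classical_of_bounded_mild_L3_of_knss2009_smoothing` (`MildL3SmoothOfKNSS.lean`: the statement
from the KNSS smoothing fact (P) `knss2009_smoothing ℝ³`), and (P) on `ℝ³` follows from the
discharged local form (`knss2009_smoothing_three_of_local`, `NSBoundedMildOseenAssembly.lean`,
with `knss2009_local_smoothing_holds`, `KNSSLocalSmoothingHolds.lean`).

Theorem-only glue module: no definitions, no named facts, no `sorry`; the theorem is a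
composition of accepted tree reductions with an accepted discharge (pure proof of an unchanged
statement).

## References

* P. G. Lemarié-Rieusset, *The Navier–Stokes Problem in the 21st Century*, CRC Press 2016,
  Thm. 9.12 (PDF pp. 260–263). [LemarieRieusset2016]
* Y. Giga, *Solutions for semilinear parabolic equations in `Lᵖ` and regularity of weak solutions
  of the Navier–Stokes system*, J. Differential Equations 62 (1986) 186–212, Thm. 4, Remark
  p. 202. [Giga1986]
* G. Koch, N. Nadirashvili, G. Seregin, V. Šverák, Acta Math. 203 (2009) = arXiv:0709.3599,
  Prop. 4.1. [KochNadirashviliSereginSverak2009]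
-/

noncomputable section

namespace Literature.Analysis.FluidPDE

/-- **Bounded mild `L³` solutions are classical (Lemarié-Rieusset 2016, Thm. 9.12; Giga 1986,
Thm. 4), proved** (the named statement `classical_of_bounded_mild_L3`), by
`classical_of_bounded_mild_L3_of_knss2009_smoothing`, `knss2009_smoothing_three_of_local` and
`knss2009_local_smoothing_holds`. [cite: LemarieRieusset2016, Thm. 9.12] [cite: Giga1986, Thm. 4, Remark (p. 202)] [cite: KochNadirashviliSereginSverak2009, Prop. 4.1] -/
theorem classical_of_bounded_mild_L3_holds : classical_of_bounded_mild_L3 :=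
  classical_of_bounded_mild_L3_of_knss2009_smoothing
    (knss2009_smoothing_three_of_local (knss2009_local_smoothing_holds (EuclideanSpace ℝ (Fin 3))))

end Literature.Analysis.FluidPDE

end
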